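/-
Copyright: the b2b-balaban T⁴-continuum CRUX team, row NE7b OWNER lineage `t4-ne7b-p1` (gen 107). Project licence.
-/
import Literature.Probability.Moments.BrascampLiebVarianceViaPrekopaLeindler
import Mathlib.MeasureTheory.Measure.Haar.NormedSpace
import Mathlib.Analysis.Calculus.ParametricIntegral

/-!
# THE VIRIAL INEQUALITY ON A CONVEX WINDOW: `∫_K ⟪∇V(y), y⟫ e^{−V} ≤ n·∫_K e^{−V}` for `K` CONVEX BOUNDED with `0 ∈ K` — the boundary
# term of the by-parts has a SIGN on a convex window (captured WITHOUT a boundary integral, by SCALING MONOTONICITY) —, whence the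
# CENTRING letter of the windowed convexity road: `λ·∫‖y‖² dν_{V,K} ≤ n` and `|∫⟪u,y⟫ dν_{V,K}| ≤ ‖u‖·√(n∕λ)` (row NE7b, node U5c;
# the (R1″)-class tilted-mean letter on the window; kernel theorems)

Cell `pub-balaban`, sub-cell `t4`, spine estimate NE7b (`T4WeightBudget.RelWeightBound`; the cell's OWN estimate — NOT PRINTED in
[Bałaban 1983–89], NOT PROVED).  Crux-route work under `Spine/NE7b/` by the row's OWNER; NOTHING of Bałaban's is named or asserted;
no `T4Continuum/Support` leaf typed; no `def`; zero `sorry`.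

WHY.  The windowed convexity road (`…NE7b.ConvexWindowTiltMoment`, σ-ne7bref-g68-2 as a theorem) displays the WINDOWED tilted means
`m_k = ∫⟪u_k, y⟫ dν_{V,K}`, `ν_{V,K} = 1_K e^{−V}dy ∕ ∫_K e^{−V}`.  On the whole carrier the centring letter `|m_u − ⟪u, x₀⟫| ≤ ‖u‖√(n∕λ)`
follows from the VIRIAL IDENTITY `∫ DV(y)[y − x₀] e^{−V} = n∫e^{−V}` (integration by parts; leaf-03 g140 `TiltedMeanNearMinimiser`).
On a WINDOW the by-parts carries a boundary term — but for a CONVEX window containing the centre it has a SIGN: for `K` convex with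
`0 ∈ K` and `0 < t ≤ 1`, `t•K ⊆ K`, so `t ↦ ∫_{t•K} e^{−V} = tⁿ ∫_K e^{−V(t•y)} dy` is at most its value at `t = 1`; its derivative at
`t = 1⁻`, `n∫_K e^{−V} − ∫_K DV(y)[y] e^{−V}`, is therefore `≥ 0`.  THIS FILE proves exactly that, with the derivative taken under the
integral sign (Mathlib's `hasDerivAt_integral_of_dominated_loc_of_deriv_le`; the window is bounded and `V ∈ C¹`, so a constant
dominates) and the sign read off the left slopes — no boundary integral, no divergence theorem.  With `λ`-uniform convexity of `V` ON `K`
(the road's first-order letter between points of `K`) and the variational letter `0 ≤ ⟪∇V 0, y⟫` on `K` (e.g. `∇V 0 = 0`, or `0`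
minimises `V` on `K`): `λ‖y‖² ≤ ⟪∇V y, y⟫` on `K`, hence `λ∫_K ‖y‖² e^{−V} ≤ n∫_K e^{−V}` — the window costs NOTHING against the
whole-carrier letter `n∕λ` (no `(Λ∕λ)^{n∕2}`, no upper pinch).

WHAT IS PROVED ([folklore] real analysis):
* §1 `pow_mul_setIntegral_exp_neg_smul_le`: `tⁿ ∫_K e^{−V(t•y)} dy ≤ ∫_K e^{−V}` for `0 < t ≤ 1` (Haar scaling `setIntegral_comp_smul_of_pos`
  + `t•K ⊆ K`).
* §2 `hasDerivAt_setIntegral_exp_neg_smul`: `t ↦ ∫_K e^{−V(t•y)} dy` has derivative `−∫_K DV(y)[y] e^{−V}` at `t = 1`.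
* §3 **`setIntegral_fderiv_apply_mul_exp_neg_le`**: `∫_K DV(y)[y]·e^{−V y} dy ≤ n·∫_K e^{−V}` (`K` convex, bounded, measurable, `0 ∈ K`;
  `V ∈ C¹`).
* §4 **`setIntegral_norm_sq_mul_exp_neg_le`**: `λ·∫_K ‖y‖² e^{−V} ≤ n·∫_K e^{−V}` under the road's letter ON `K` and `0 ≤ ⟪∇V 0, y⟫` on `K`;
  **`integral_norm_sq_windowTilted_le`**: `∫‖y‖² dν_{V,K} ≤ n∕λ`; **`abs_windowTiltedMean_inner_le`**: `|∫⟪u,y⟫ dν_{V,K}| ≤ ‖u‖·√(n∕λ)`.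

NOT HERE (honest): the centre — that print's expansion point is the `0` of the fresh variables with `⟪∇V 0, ·⟫ ≥ 0` on the window is an
(A1c)∕(A3) reading (leaf-03's `ConvexMinimiser` supplies the critical point of a coercive `C¹` exponent; a translate `y ↦ y − x₀` of
this file is bookkeeping) —; unbounded windows; anything of Bałaban's.  NE7b NOT PRINTED ∕ NOT PROVED; spine PROVED 0∕9; rung (B)+1 on a
FINITE torus — NOT infinite volume, NOT the mass gap, NOT Clay.
HONEST DEPENDENCY: continuum YM on T⁴ ⇐ BetaPertH ∧ nine spine estimates (0/9 proved); BetaPertH ⇐ (D1) ∧ (D4) ∧ CAP+tail.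
-/

set_option autoImplicit false

noncomputable section

open MeasureTheory Real Set Filter Topology Metric InnerProductSpace
open scoped RealInnerProductSpace Pointwise

namespace Summit.QuantumFields.BalabanUV.T4Continuum.NE7b.ConvexWindowVirial

variable {n : ℕ}

/-! ## §0 Integrability on a bounded window -/

/-- A continuous function is integrable on a bounded set. [folklore] -/
theorem integrableOn_of_isBounded {f : EuclideanSpace ℝ (Fin n) → ℝ} {K : Set (EuclideanSpace ℝ (Fin n))}
    (hKb : Bornology.IsBounded K) (hf : Continuous f) : IntegrableOn f K :=
  (hf.continuousOn.integrableOn_compact hKb.isCompact_closure).mono_set subset_closure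

/-! ## §1 Scaling monotonicity: `tⁿ ∫_K e^{−V(t•y)} dy = ∫_{t•K} e^{−V} ≤ ∫_K e^{−V}` -/

/-- **SCALING MONOTONICITY.**  For `K` convex with `0 ∈ K`, `e^{−V}` integrable on `K` and `0 < t ≤ 1`:
`tⁿ·∫_K e^{−V(t•y)} dy ≤ ∫_K e^{−V(y)} dy` — the left side is `∫_{t•K} e^{−V}` by Haar scaling and `t•K ⊆ K`. [folklore] -/
theorem pow_mul_setIntegral_exp_neg_smul_le {V : EuclideanSpace ℝ (Fin n) → ℝ} {K : Set (EuclideanSpace ℝ (Fin n))}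
    (hK : Convex ℝ K) (h0 : (0 : EuclideanSpace ℝ (Fin n)) ∈ K) (hZ : IntegrableOn (fun x => exp (-V x)) K)
    {t : ℝ} (ht0 : 0 < t) (ht1 : t ≤ 1) :
    t ^ n * ∫ y in K, exp (-V (t • y)) ≤ ∫ y in K, exp (-V y) := by
  have hsub : t • K ⊆ K := by
    rintro _ ⟨y, hy, rfl⟩
    exact hK.smul_mem_of_zero_mem h0 hy ⟨ht0.le, ht1⟩
  have hscale := Measure.setIntegral_comp_smul_of_pos volume (fun z => exp (-V z)) K ht0
  rw [finrank_euclideanSpace_fin, smul_eq_mul] at hscale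
  rw [hscale, ← mul_assoc, mul_inv_cancel₀ (pow_ne_zero _ ht0.ne'), one_mul]
  exact setIntegral_mono_set hZ (ae_of_all _ fun _ => (exp_pos _).le) (ae_of_all _ hsub)

/-! ## §2 The derivative of `t ↦ ∫_K e^{−V(t•y)} dy` at `t = 1`, under the integral sign -/

/-- On a bounded window, `(t, y) ↦ DV(t•y)[y]·e^{−V(t•y)}` is bounded for `t ∈ [½, 3∕2]`, `y ∈ K` (`V ∈ C¹`). [folklore] -/
theorem exists_bound_fderiv_smul {V : EuclideanSpace ℝ (Fin n) → ℝ} {K : Set (EuclideanSpace ℝ (Fin n))}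
    (hKb : Bornology.IsBounded K) (hV : ContDiff ℝ 1 V) :
    ∃ C : ℝ, ∀ t ∈ Icc (1 / 2 : ℝ) (3 / 2), ∀ y ∈ K, ‖exp (-V (t • y)) * -(fderiv ℝ V (t • y) y)‖ ≤ C := by
  have hDc : Continuous (fderiv ℝ V) := hV.continuous_fderiv one_ne_zero
  have hsm : Continuous fun p : ℝ × EuclideanSpace ℝ (Fin n) => p.1 • p.2 := continuous_smul
  have hg : Continuous fun p : ℝ × EuclideanSpace ℝ (Fin n) => exp (-V (p.1 • p.2)) * -(fderiv ℝ V (p.1 • p.2) p.2) :=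
    (hV.continuous.comp hsm).neg.rexp.mul ((hDc.comp hsm).clm_apply continuous_snd).neg
  obtain ⟨C, hC⟩ := (isCompact_Icc.prod hKb.isCompact_closure).exists_bound_of_continuousOn hg.continuousOn
  exact ⟨C, fun t ht y hy => hC (t, y) ⟨ht, subset_closure hy⟩⟩

/-- **DIFFERENTIATION UNDER THE INTEGRAL SIGN**: for `K` bounded measurable and `V ∈ C¹`, `t ↦ ∫_K e^{−V(t•y)} dy` has derivative
`∫_K e^{−V(y)}·(−DV(y)[y]) dy` at `t = 1`. [folklore] -/
theorem hasDerivAt_setIntegral_exp_neg_smul {V : EuclideanSpace ℝ (Fin n) → ℝ} {K : Set (EuclideanSpace ℝ (Fin n))}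
    (hKm : MeasurableSet K) (hKb : Bornology.IsBounded K) (hV : ContDiff ℝ 1 V) :
    HasDerivAt (fun t : ℝ => ∫ y in K, exp (-V (t • y)))
      (∫ y in K, exp (-V ((1 : ℝ) • y)) * -(fderiv ℝ V ((1 : ℝ) • y) y)) 1 := by
  haveI : IsFiniteMeasure (volume.restrict K) := isFiniteMeasure_restrict.2 hKb.measure_lt_top.ne
  have hDc : Continuous (fderiv ℝ V) := hV.continuous_fderiv one_ne_zero
  have hdiff : Differentiable ℝ V := hV.differentiable one_ne_zero
  obtain ⟨C, hC⟩ := exists_bound_fderiv_smul hKb hV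
  have hs : Icc (1 / 2 : ℝ) (3 / 2) ∈ 𝓝 (1 : ℝ) := Icc_mem_nhds (by norm_num) (by norm_num)
  -- continuity in `y` at fixed `t`
  have hFc : ∀ t : ℝ, Continuous fun y : EuclideanSpace ℝ (Fin n) => exp (-V (t • y)) := fun t => by
    have h : Continuous fun y : EuclideanSpace ℝ (Fin n) => V (t • y) := hV.continuous.comp (continuous_const_smul t)
    exact h.neg.rexp
  have hF'c : ∀ t : ℝ, Continuous fun y : EuclideanSpace ℝ (Fin n) => exp (-V (t • y)) * -(fderiv ℝ V (t • y) y) := fun t => by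
    have h1 : Continuous fun y : EuclideanSpace ℝ (Fin n) => fderiv ℝ V (t • y) := hDc.comp (continuous_const_smul t)
    exact (hFc t).mul (h1.clm_apply continuous_id).neg
  refine (hasDerivAt_integral_of_dominated_loc_of_deriv_le (μ := volume.restrict K)
    (F := fun t y => exp (-V (t • y))) (F' := fun t y => exp (-V (t • y)) * -(fderiv ℝ V (t • y) y))
    (bound := fun _ => C) hs (Eventually.of_forall fun t => (hFc t).aestronglyMeasurable) ?_
    (hF'c 1).aestronglyMeasurable ?_ (integrable_const C) ?_).2
  · exact (integrableOn_of_isBounded hKb (hFc 1))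
  · exact ae_restrict_of_forall_mem hKm fun y hy t ht => hC t ht y hy
  · refine ae_of_all _ fun y t _ => ?_
    have h1 : HasDerivAt (fun s : ℝ => s • y) y t := by
      simpa using (hasDerivAt_id t).smul_const y
    have h2 : HasDerivAt (fun s : ℝ => V (s • y)) (fderiv ℝ V (t • y) y) t :=
      (hdiff (t • y)).hasFDerivAt.comp_hasDerivAt t h1
    exact h2.neg.exp

/-! ## §3 The virial inequality on a convex window -/

/-- **THE VIRIAL INEQUALITY ON A CONVEX WINDOW.**  For `K` convex, bounded and measurable with `0 ∈ K`, and `V ∈ C¹`: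
`∫_K DV(y)[y]·e^{−V(y)} dy ≤ n·∫_K e^{−V(y)} dy`.  (On the whole space this is the virial IDENTITY; on a convex window the boundary
flux `∫_{∂K} ⟪y, ν⟫e^{−V} ≥ 0` is dropped — here via scaling monotonicity and the left slopes at `t = 1`.) [folklore] -/
theorem setIntegral_fderiv_apply_mul_exp_neg_le {V : EuclideanSpace ℝ (Fin n) → ℝ} {K : Set (EuclideanSpace ℝ (Fin n))}
    (hK : Convex ℝ K) (hKm : MeasurableSet K) (hKb : Bornology.IsBounded K) (h0 : (0 : EuclideanSpace ℝ (Fin n)) ∈ K)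
    (hV : ContDiff ℝ 1 V) :
    ∫ y in K, fderiv ℝ V y y * exp (-V y) ≤ (n : ℝ) * ∫ y in K, exp (-V y) := by
  have hZ : IntegrableOn (fun x => exp (-V x)) K := integrableOn_of_isBounded hKb hV.continuous.neg.rexp
  -- the function `Ψ t = tⁿ ∫_K e^{−V(t•y)}` and its derivative at `1`
  have hΦ := hasDerivAt_setIntegral_exp_neg_smul hKm hKb hV
  simp only [one_smul] at hΦ
  have hΨ : HasDerivAt (fun t : ℝ => t ^ n * ∫ y in K, exp (-V (t • y)))
      ((n : ℝ) * (1 : ℝ) ^ (n - 1) * (∫ y in K, exp (-V ((1 : ℝ) • y))) +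
        (1 : ℝ) ^ n * ∫ y in K, exp (-V y) * -(fderiv ℝ V y y)) 1 :=
    (hasDerivAt_pow n (1 : ℝ)).mul hΦ
  simp only [one_pow, mul_one, one_mul, one_smul] at hΨ
  -- the left slopes at `1` are non-negative
  have hslope := (hasDerivAt_iff_tendsto_slope.1 hΨ).mono_left (nhdsLT_le_nhdsNE (1 : ℝ))
  have hev : ∀ᶠ t in 𝓝[<] (1 : ℝ), 0 ≤ slope (fun t : ℝ => t ^ n * ∫ y in K, exp (-V (t • y))) 1 t := by
    filter_upwards [Ioo_mem_nhdsLT (show (1 / 2 : ℝ) < 1 by norm_num)] with t ht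
    have hmono := pow_mul_setIntegral_exp_neg_smul_le hK h0 hZ (t := t) (by linarith [ht.1]) ht.2.le
    simp only [slope_def_field, one_pow, one_mul, one_smul]
    exact div_nonneg_of_nonpos (by linarith) (by linarith [ht.2])
  have hD := ge_of_tendsto hslope hev
  -- `∫ e^{−V}·(−DV[y]) = −∫ DV[y]·e^{−V}`
  have e : ∫ y in K, exp (-V y) * -(fderiv ℝ V y y) = -∫ y in K, fderiv ℝ V y y * exp (-V y) := by
    rw [← integral_neg]
    exact integral_congr_ae (ae_of_all _ fun y => by ring)
  rw [e] at hD
  linarith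

/-! ## §4 The centring letter of the windowed road -/

/-- `⟪∇V y, v⟫ = DV(y)[v]`. [folklore] -/
theorem inner_gradient_eq_fderiv (V : EuclideanSpace ℝ (Fin n) → ℝ) (y v : EuclideanSpace ℝ (Fin n)) :
    ⟪gradient V y, v⟫ = fderiv ℝ V y v := by
  unfold gradient
  exact toDual_symm_apply

/-- From the road's first-order letter ON `K` at `0` and at `y` plus the variational letter `0 ≤ ⟪∇V 0, y⟫`:
`λ‖y‖² ≤ DV(y)[y]` for `y ∈ K`. [folklore] -/
theorem norm_sq_le_fderiv_apply_of_uniformlyConvexOn {V : EuclideanSpace ℝ (Fin n) → ℝ} {lam : ℝ}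
    {K : Set (EuclideanSpace ℝ (Fin n))} (h0 : (0 : EuclideanSpace ℝ (Fin n)) ∈ K)
    (hV : ∀ x ∈ K, ∀ y ∈ K, V x + ⟪gradient V x, y - x⟫ + lam / 2 * ‖y - x‖ ^ 2 ≤ V y)
    (hcrit : ∀ y ∈ K, 0 ≤ ⟪gradient V 0, y⟫) {y : EuclideanSpace ℝ (Fin n)} (hy : y ∈ K) :
    lam * ‖y‖ ^ 2 ≤ fderiv ℝ V y y := by
  have h1 := hV 0 h0 y hy
  have h2 := hV y hy 0 h0
  have h3 := hcrit y hy
  simp only [sub_zero] at h1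
  simp only [zero_sub, inner_neg_right, norm_neg] at h2
  rw [inner_gradient_eq_fderiv] at h2
  linarith

/-- **THE WINDOWED SECOND MOMENT**: `K` convex, bounded, measurable, `0 ∈ K`; `V ∈ C¹`, `λ`-uniformly convex ON `K` (first-order letter
between points of `K`), `0 ≤ ⟪∇V 0, y⟫` on `K`, `λ > 0`: `λ·∫_K ‖y‖² e^{−V} ≤ n·∫_K e^{−V}`. [folklore] -/
theorem setIntegral_norm_sq_mul_exp_neg_le {V : EuclideanSpace ℝ (Fin n) → ℝ} {lam : ℝ} {K : Set (EuclideanSpace ℝ (Fin n))}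
    (hK : Convex ℝ K) (hKm : MeasurableSet K) (hKb : Bornology.IsBounded K) (h0 : (0 : EuclideanSpace ℝ (Fin n)) ∈ K)
    (hV1 : ContDiff ℝ 1 V)
    (hV : ∀ x ∈ K, ∀ y ∈ K, V x + ⟪gradient V x, y - x⟫ + lam / 2 * ‖y - x‖ ^ 2 ≤ V y)
    (hcrit : ∀ y ∈ K, 0 ≤ ⟪gradient V 0, y⟫) :
    lam * ∫ y in K, ‖y‖ ^ 2 * exp (-V y) ≤ (n : ℝ) * ∫ y in K, exp (-V y) := by
  have hDc : Continuous (fderiv ℝ V) := hV1.continuous_fderiv one_ne_zero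
  have hI1 : IntegrableOn (fun y : EuclideanSpace ℝ (Fin n) => ‖y‖ ^ 2 * exp (-V y)) K :=
    integrableOn_of_isBounded hKb ((continuous_norm.pow 2).mul hV1.continuous.neg.rexp)
  have hI2 : IntegrableOn (fun y : EuclideanSpace ℝ (Fin n) => fderiv ℝ V y y * exp (-V y)) K :=
    integrableOn_of_isBounded hKb ((hDc.clm_apply continuous_id).mul hV1.continuous.neg.rexp)
  refine le_trans ?_ (setIntegral_fderiv_apply_mul_exp_neg_le hK hKm hKb h0 hV1)
  rw [← integral_const_mul]
  refine setIntegral_mono_on (hI1.const_mul lam) hI2 hKm fun y hy => ?_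
  have h := norm_sq_le_fderiv_apply_of_uniformlyConvexOn h0 hV hcrit hy
  have he := exp_pos (-V y)
  calc lam * (‖y‖ ^ 2 * exp (-V y)) = (lam * ‖y‖ ^ 2) * exp (-V y) := by ring
    _ ≤ fderiv ℝ V y y * exp (-V y) := mul_le_mul_of_nonneg_right h he.le

/-- **THE WINDOWED TILTED SECOND MOMENT**: under the hypotheses of `setIntegral_norm_sq_mul_exp_neg_le` with `λ > 0` and `volume K ≠ 0`,
`∫ ‖y‖² dν_{V,K} ≤ n∕λ` for `ν_{V,K} = 1_K e^{−V} ∕ ∫_K e^{−V}`. [folklore] -/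
theorem integral_norm_sq_windowTilted_le {V : EuclideanSpace ℝ (Fin n) → ℝ} {lam : ℝ} {K : Set (EuclideanSpace ℝ (Fin n))}
    (hlam : 0 < lam) (hK : Convex ℝ K) (hKm : MeasurableSet K) (hKb : Bornology.IsBounded K)
    (hK0 : volume K ≠ 0) (h0 : (0 : EuclideanSpace ℝ (Fin n)) ∈ K) (hV1 : ContDiff ℝ 1 V)
    (hV : ∀ x ∈ K, ∀ y ∈ K, V x + ⟪gradient V x, y - x⟫ + lam / 2 * ‖y - x‖ ^ 2 ≤ V y)
    (hcrit : ∀ y ∈ K, 0 ≤ ⟪gradient V 0, y⟫) :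
    ∫ y, ‖y‖ ^ 2 ∂((volume.restrict K).tilted fun x => -V x) ≤ n / lam := by
  haveI : NeZero (volume.restrict K : Measure (EuclideanSpace ℝ (Fin n))) :=
    ⟨fun h => hK0 (Measure.restrict_eq_zero.1 h)⟩
  have hZ : IntegrableOn (fun x => exp (-V x)) K := integrableOn_of_isBounded hKb hV1.continuous.neg.rexp
  have hZpos : 0 < ∫ x in K, exp (-V x) := integral_exp_pos hZ
  have T : ∫ y, ‖y‖ ^ 2 ∂((volume.restrict K).tilted fun x => -V x) =
      (∫ y in K, ‖y‖ ^ 2 * exp (-V y)) / ∫ x in K, exp (-V x) := by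
    rw [integral_tilted, ← integral_div]
    congr 1; ext y; rw [smul_eq_mul]; ring
  rw [T, div_le_div_iff₀ hZpos hlam]
  have h := setIntegral_norm_sq_mul_exp_neg_le hK hKm hKb h0 hV1 hV hcrit
  linarith

/-- `(∫ f dν)² ≤ ∫ f² dν` for a probability measure (the variance is non-negative). [folklore] -/
theorem sq_integral_le_integral_sq {X : Type*} [MeasurableSpace X] (ν : Measure X) [IsProbabilityMeasure ν] {f : X → ℝ}
    (h1 : Integrable f ν) (h2 : Integrable (fun x => f x ^ 2) ν) :
    (∫ x, f x ∂ν) ^ 2 ≤ ∫ x, f x ^ 2 ∂ν := by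
  set c := ∫ x, f x ∂ν with hc
  have hnn : 0 ≤ ∫ x, (f x - c) ^ 2 ∂ν := integral_nonneg fun x => sq_nonneg _
  have e : ∀ x, (f x - c) ^ 2 = f x ^ 2 - 2 * c * f x + c ^ 2 := fun x => by ring
  simp_rw [e] at hnn
  have hI : Integrable (fun x => f x ^ 2 - 2 * c * f x) ν := h2.sub (h1.const_mul (2 * c))
  rw [integral_add hI (integrable_const _), integral_sub h2 (h1.const_mul (2 * c)), integral_const_mul, integral_const,
    smul_eq_mul, probReal_univ, one_mul, ← hc] at hnn
  nlinarith

/-- **THE CENTRING LETTER OF THE WINDOWED ROAD**: under the hypotheses of `integral_norm_sq_windowTilted_le`,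
`|∫⟪u, y⟫ dν_{V,K}| ≤ ‖u‖·√(n∕λ)` — the windowed tilted mean of every linear functional sits within `‖u‖√(n∕λ)` of its value at the
centre `0`. [folklore] -/
theorem abs_windowTiltedMean_inner_le {V : EuclideanSpace ℝ (Fin n) → ℝ} {lam : ℝ} {K : Set (EuclideanSpace ℝ (Fin n))}
    (hlam : 0 < lam) (hK : Convex ℝ K) (hKm : MeasurableSet K) (hKb : Bornology.IsBounded K)
    (hK0 : volume K ≠ 0) (h0 : (0 : EuclideanSpace ℝ (Fin n)) ∈ K) (hV1 : ContDiff ℝ 1 V)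
    (hV : ∀ x ∈ K, ∀ y ∈ K, V x + ⟪gradient V x, y - x⟫ + lam / 2 * ‖y - x‖ ^ 2 ≤ V y)
    (hcrit : ∀ y ∈ K, 0 ≤ ⟪gradient V 0, y⟫) (u : EuclideanSpace ℝ (Fin n)) :
    |∫ y, ⟪u, y⟫ ∂((volume.restrict K).tilted fun x => -V x)| ≤ ‖u‖ * Real.sqrt (n / lam) := by
  haveI : NeZero (volume.restrict K : Measure (EuclideanSpace ℝ (Fin n))) :=
    ⟨fun h => hK0 (Measure.restrict_eq_zero.1 h)⟩
  have hZ : IntegrableOn (fun x => exp (-V x)) K := integrableOn_of_isBounded hKb hV1.continuous.neg.rexp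
  set ν : Measure (EuclideanSpace ℝ (Fin n)) := (volume.restrict K).tilted fun x => -V x with hν
  haveI : IsProbabilityMeasure ν := isProbabilityMeasure_tilted hZ
  -- integrability of the three test functions under the windowed tilt (bounded window)
  have hint : ∀ f : EuclideanSpace ℝ (Fin n) → ℝ, Continuous f → Integrable f ν := fun f hf => by
    rw [hν, integrable_tilted_iff hZ f]
    have h : Integrable (fun x => exp (-V x) * f x) (volume.restrict K) :=
      integrableOn_of_isBounded hKb (hV1.continuous.neg.rexp.mul hf)
    simpa only [smul_eq_mul] using h
  have hi1 : Integrable (fun y : EuclideanSpace ℝ (Fin n) => ⟪u, y⟫) ν := hint _ (continuous_const.inner continuous_id)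
  have hi2 : Integrable (fun y : EuclideanSpace ℝ (Fin n) => ⟪u, y⟫ ^ 2) ν := hint _ ((continuous_const.inner continuous_id).pow 2)
  have hi3 : Integrable (fun y : EuclideanSpace ℝ (Fin n) => ‖y‖ ^ 2) ν := hint _ (continuous_norm.pow 2)
  -- `(∫⟪u,y⟫)² ≤ ∫⟪u,y⟫² ≤ ‖u‖² ∫‖y‖² ≤ ‖u‖²·n∕λ`
  have hA := sq_integral_le_integral_sq ν hi1 hi2
  have hB : ∫ y, ⟪u, y⟫ ^ 2 ∂ν ≤ ‖u‖ ^ 2 * ∫ y, ‖y‖ ^ 2 ∂ν := by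
    rw [← integral_const_mul]
    refine integral_mono hi2 (hi3.const_mul _) fun y => ?_
    have h := pow_le_pow_left₀ (abs_nonneg _) (abs_real_inner_le_norm u y) 2
    rw [sq_abs, mul_pow] at h
    exact h
  have hC := integral_norm_sq_windowTilted_le hlam hK hKm hKb hK0 h0 hV1 hV hcrit
  have hsq : (∫ y, ⟪u, y⟫ ∂ν) ^ 2 ≤ (‖u‖ * Real.sqrt (n / lam)) ^ 2 := by
    rw [mul_pow, Real.sq_sqrt (div_nonneg (Nat.cast_nonneg n) hlam.le)]
    exact hA.trans (hB.trans (mul_le_mul_of_nonneg_left hC (sq_nonneg _)))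
  exact abs_le_of_sq_le_sq hsq (mul_nonneg (norm_nonneg _) (Real.sqrt_nonneg _))

/-! ## §5 A general centre `x₀ ∈ K` (appended gen 107, same seat): translation to the `0`-centred case -/

/-- Change of variables `y = z + x₀` for window integrals: `∫_K F = ∫_{K − x₀} F(· + x₀)`, `K − x₀ := (· + x₀)⁻¹' K`. [folklore] -/
theorem setIntegral_eq_setIntegral_preimage_add (K : Set (EuclideanSpace ℝ (Fin n))) (hKm : MeasurableSet K)
    (x₀ : EuclideanSpace ℝ (Fin n)) (F : EuclideanSpace ℝ (Fin n) → ℝ) :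
    ∫ y in K, F y = ∫ z in (fun z => z + x₀) ⁻¹' K, F (z + x₀) := by
  rw [← integral_indicator hKm, ← integral_indicator (hKm.preimage (measurable_add_const x₀)),
    ← integral_add_right_eq_self (fun y => K.indicator F y) x₀]
  congr 1

/-- **THE VIRIAL INEQUALITY ON A CONVEX WINDOW, GENERAL CENTRE.**  For `K` convex, bounded and measurable, `x₀ ∈ K`, and `V ∈ C¹`:
`∫_K DV(y)[y − x₀]·e^{−V(y)} dy ≤ n·∫_K e^{−V(y)} dy` — the `0`-centred `setIntegral_fderiv_apply_mul_exp_neg_le` after the translation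
`y = z + x₀` (a MOVING centre, e.g. a background-dependent minimiser, costs nothing). [folklore] -/
theorem setIntegral_fderiv_apply_sub_mul_exp_neg_le {V : EuclideanSpace ℝ (Fin n) → ℝ} {K : Set (EuclideanSpace ℝ (Fin n))}
    (hK : Convex ℝ K) (hKm : MeasurableSet K) (hKb : Bornology.IsBounded K) {x₀ : EuclideanSpace ℝ (Fin n)} (hx₀ : x₀ ∈ K)
    (hV : ContDiff ℝ 1 V) :
    ∫ y in K, fderiv ℝ V y (y - x₀) * exp (-V y) ≤ (n : ℝ) * ∫ y in K, exp (-V y) := by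
  set K₀ : Set (EuclideanSpace ℝ (Fin n)) := (fun z => z + x₀) ⁻¹' K with hK₀
  have hK₀c : Convex ℝ K₀ := hK.translate_preimage_left x₀
  have hK₀m : MeasurableSet K₀ := hKm.preimage (measurable_add_const x₀)
  have h0 : (0 : EuclideanSpace ℝ (Fin n)) ∈ K₀ := by
    show (0 : EuclideanSpace ℝ (Fin n)) + x₀ ∈ K
    simpa using hx₀
  have hK₀b : Bornology.IsBounded K₀ := by
    obtain ⟨R, hR⟩ := (Metric.isBounded_iff_subset_closedBall (0 : EuclideanSpace ℝ (Fin n))).1 hKb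
    refine (Metric.isBounded_iff_subset_closedBall (0 : EuclideanSpace ℝ (Fin n))).2 ⟨R + ‖x₀‖, fun z hz => ?_⟩
    have h1 : ‖z + x₀‖ ≤ R := by simpa [Metric.mem_closedBall, dist_zero_right] using hR hz
    rw [Metric.mem_closedBall, dist_zero_right]
    calc ‖z‖ = ‖(z + x₀) - x₀‖ := by rw [add_sub_cancel_right]
      _ ≤ ‖z + x₀‖ + ‖x₀‖ := norm_sub_le _ _
      _ ≤ R + ‖x₀‖ := by linarith
  have hV₀ : ContDiff ℝ 1 (fun z : EuclideanSpace ℝ (Fin n) => V (z + x₀)) := hV.comp (contDiff_id.add contDiff_const)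
  have key := setIntegral_fderiv_apply_mul_exp_neg_le hK₀c hK₀m hK₀b h0 hV₀
  have hD : ∀ z : EuclideanSpace ℝ (Fin n), fderiv ℝ (fun z : EuclideanSpace ℝ (Fin n) => V (z + x₀)) z = fderiv ℝ V (z + x₀) :=
    fun z => fderiv_comp_add_right x₀
  simp_rw [hD] at key
  rw [setIntegral_eq_setIntegral_preimage_add K hKm x₀ (fun y => fderiv ℝ V y (y - x₀) * exp (-V y)),
    setIntegral_eq_setIntegral_preimage_add K hKm x₀ (fun y => exp (-V y))]
  simp only [add_sub_cancel_right]
  exact key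

/-- From the road's first-order letter ON `K` at `x₀` and at `y` plus the variational letter `0 ≤ ⟪∇V x₀, y − x₀⟫`:
`λ‖y − x₀‖² ≤ DV(y)[y − x₀]` for `y ∈ K`. [folklore] -/
theorem norm_sub_sq_le_fderiv_apply_of_uniformlyConvexOn {V : EuclideanSpace ℝ (Fin n) → ℝ} {lam : ℝ}
    {K : Set (EuclideanSpace ℝ (Fin n))} {x₀ : EuclideanSpace ℝ (Fin n)} (hx₀ : x₀ ∈ K)
    (hV : ∀ x ∈ K, ∀ y ∈ K, V x + ⟪gradient V x, y - x⟫ + lam / 2 * ‖y - x‖ ^ 2 ≤ V y)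
    (hcrit : ∀ y ∈ K, 0 ≤ ⟪gradient V x₀, y - x₀⟫) {y : EuclideanSpace ℝ (Fin n)} (hy : y ∈ K) :
    lam * ‖y - x₀‖ ^ 2 ≤ fderiv ℝ V y (y - x₀) := by
  have h1 := hV x₀ hx₀ y hy
  have h2 := hV y hy x₀ hx₀
  have h3 := hcrit y hy
  have e1 : x₀ - y = -(y - x₀) := by abel
  rw [e1, inner_neg_right, norm_neg, inner_gradient_eq_fderiv] at h2
  linarith

/-- **THE WINDOWED SECOND MOMENT ABOUT A GENERAL CENTRE**: `K` convex, bounded, measurable, `x₀ ∈ K`; `V ∈ C¹`, `λ`-uniformly convex ON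
`K`, `0 ≤ ⟪∇V x₀, y − x₀⟫` on `K` (e.g. `∇V x₀ = 0`, or `x₀` minimises `V` on `K`): `λ·∫_K ‖y − x₀‖² e^{−V} ≤ n·∫_K e^{−V}`. [folklore] -/
theorem setIntegral_norm_sub_sq_mul_exp_neg_le {V : EuclideanSpace ℝ (Fin n) → ℝ} {lam : ℝ} {K : Set (EuclideanSpace ℝ (Fin n))}
    (hK : Convex ℝ K) (hKm : MeasurableSet K) (hKb : Bornology.IsBounded K) {x₀ : EuclideanSpace ℝ (Fin n)} (hx₀ : x₀ ∈ K)
    (hV1 : ContDiff ℝ 1 V)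
    (hV : ∀ x ∈ K, ∀ y ∈ K, V x + ⟪gradient V x, y - x⟫ + lam / 2 * ‖y - x‖ ^ 2 ≤ V y)
    (hcrit : ∀ y ∈ K, 0 ≤ ⟪gradient V x₀, y - x₀⟫) :
    lam * ∫ y in K, ‖y - x₀‖ ^ 2 * exp (-V y) ≤ (n : ℝ) * ∫ y in K, exp (-V y) := by
  have hDc : Continuous (fderiv ℝ V) := hV1.continuous_fderiv one_ne_zero
  have hI1 : IntegrableOn (fun y : EuclideanSpace ℝ (Fin n) => ‖y - x₀‖ ^ 2 * exp (-V y)) K :=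
    integrableOn_of_isBounded hKb (((continuous_id.sub continuous_const).norm.pow 2).mul hV1.continuous.neg.rexp)
  have hI2 : IntegrableOn (fun y : EuclideanSpace ℝ (Fin n) => fderiv ℝ V y (y - x₀) * exp (-V y)) K :=
    integrableOn_of_isBounded hKb ((hDc.clm_apply (continuous_id.sub continuous_const)).mul hV1.continuous.neg.rexp)
  refine le_trans ?_ (setIntegral_fderiv_apply_sub_mul_exp_neg_le hK hKm hKb hx₀ hV1)
  rw [← integral_const_mul]
  refine setIntegral_mono_on (hI1.const_mul lam) hI2 hKm fun y hy => ?_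
  have h := norm_sub_sq_le_fderiv_apply_of_uniformlyConvexOn hx₀ hV hcrit hy
  have he := exp_pos (-V y)
  calc lam * (‖y - x₀‖ ^ 2 * exp (-V y)) = (lam * ‖y - x₀‖ ^ 2) * exp (-V y) := by ring
    _ ≤ fderiv ℝ V y (y - x₀) * exp (-V y) := mul_le_mul_of_nonneg_right h he.le

end Summit.QuantumFields.BalabanUV.T4Continuum.NE7b.ConvexWindowVirial

end
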